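import Literature.ModelTheory.PseudofiniteFields.CharZeroUniformBound

/-!
# `PairwiseCurvedTilingsLC` (crux stmt-MatrixMultiplication-17883), line LonelyTranslates (c1) —
stub `stub_charZeroUniformBound`: a pointwise-finite first-order bound over characteristic-zero
pseudo-finite fields is uniform

Support lemma for the (conditional) refutation skeleton
`Cruxes/PairwiseCurvedTilingsLC/Lines/LonelyTranslates.lean` (continuation c1,
"Prop27Reduction"), step (4) "a uniform index over characteristic-zero pseudo-finite fields": if
in every characteristic-zero pseudo-finite field `K` (`[Field K] [CompatibleRing K] [CharZero K]`,
`K ⊨ finiteFieldTheory`) every tuple satisfies SOME formula `χ_N` of a sequence, then one `N`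
bounds the index uniformly (`∃ n ≤ N, χ_n`; no monotonicity in `N` is assumed). This is the
compactness theorem; it is proved in the Literature tree through a non-principal ultraproduct of
counterexamples and Łoś's theorem (the ultraproduct of characteristic-zero pseudo-finite fields
is again one: `Literature.ModelTheory.PseudofiniteFields.exists_uniform_bound_of_model` with
`T = finiteFieldTheory ∪ Theory.fieldOfChar 0`, specialised in
`Literature.ModelTheory.PseudofiniteFields.FiniteField.exists_uniform_bound_of_pseudoFinite_charZero`),
and restated here with the registered stub signature.
-/

set_option linter.dupNamespace false  -- `Summit.<S>.<S>.…` is the mandated namespace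

namespace Summit.MatrixMultiplication.MatrixMultiplication.Theorems.PairwiseCurvedTilingsLC.Negative

open FirstOrder FirstOrder.Language FirstOrder.Ring
open Literature.ModelTheory.PseudofiniteFields

/-- STUB `stub_charZeroUniformBound` of line LonelyTranslates (c1) (compactness over
characteristic-`0` pseudo-finite fields): if every tuple `v : α → K` of every characteristic-`0`
pseudo-finite field `K` satisfies some formula `χ_N` of the sequence `χ`, then there is one `N`
such that every tuple of every such field satisfies some `χ_n` with `n ≤ N`. Immediate from
`FiniteField.exists_uniform_bound_of_pseudoFinite_charZero` (ultraproduct of characteristic-`0`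
pseudo-finite fields is one + Łoś). -/
theorem stub_charZeroUniformBound {α : Type} (χ : ℕ → Language.ring.Formula α)
    (h : ∀ (K : Type) [Field K] [CompatibleRing K] [CharZero K], K ⊨ finiteFieldTheory →
      ∀ v : α → K, ∃ N, (χ N).Realize v) :
    ∃ N, ∀ (K : Type) [Field K] [CompatibleRing K] [CharZero K], K ⊨ finiteFieldTheory →
      ∀ v : α → K, ∃ n ≤ N, (χ n).Realize v :=
  FiniteField.exists_uniform_bound_of_pseudoFinite_charZero χ h

end Summit.MatrixMultiplication.MatrixMultiplication.Theorems.PairwiseCurvedTilingsLC.Negative
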